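import Summits.NavierStokesRegularity.NavierStokesRegularity.Theses.AngularGalerkinLadder
import Summits.NavierStokesRegularity.NavierStokesRegularity.Theorems.NoOverheating.Negative.LadderLimitExposed
import Literature.Analysis.FluidPDE.ClassicalSolutionCalculus
import HarnessLib

/-!
# KJ-69 — Slices that are DISCRETELY homogeneous of degree `−1` (one contraction factor; discrete
# Landau scaling) are excluded, exactly and asymptotically (route `AngularGalerkinLadder`, cruxes
# K1 `RungBlowupCofinal` / K2 `NoOverheating`; refuter lineage, Negative lane)

Stratum (S29), the DISCRETE sharpening of (S27) (KJ-67, which assumed homogeneity under EVERY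
contraction `λ ∈ (0, 1)`): ONE contraction factor suffices.  If `λ₀ w(λ₀ x) = w(x)` for a single
`λ₀ ∈ (0, 1)` and `w` is continuous at the origin, then `w ≡ 0`
(`eq_zero_of_discretelyHomogeneous_of_continuousAt`: iterating, `w(x) = λ₀ᵏ w(λ₀ᵏ x) → 0 · w(0)`).
This is the slice-level analogue of the ladder's own discreteness: a window slice that is
self-similar under ONE spatial contraction (a "discrete Landau profile" `w(λ₀ᵏ θ r) = λ₀^{−k} …`) is
already impossible.  Hence

* PROFILE-level (any `C₀`, rotation, factor): `rungProfile_slice_eq_zero_of_discretelyHomogeneous`,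
  `not_nontrivial_rungProfile_of_discretelyHomogeneousSlices` (K1 witnesses),
  `no_windowProfile_discretelyHomogeneousSlice` (K2 windows);
* SEQUENCE-level (any `C₀`, rotations, window): no admissible window sequence has window slices
  ASYMPTOTICALLY homogeneous under one contraction, `λ₀ uₙ(−1, λ₀ x) − uₙ(−1, x) → 0` pointwise
  (`no_windowSequence_asymptoticallyDiscretelyHomogeneousSlice`), via the Type-I ladder limit
  (`exists_ladderLimit_typeI`: pointwise slice convergence, continuity, inherited floor).

READING FOR THE CIRCUIT: not even a DISCRETE spatial self-similarity of the window slice (one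
factor, matching the ladder's discrete scaling) is available to a K2 supply.  No `kit`.
[cite: KochNadirashviliSereginSverak2009, Lemma 6.1 (limits of rescaled solutions)] -/

namespace Summit.NavierStokesRegularity.AngularGalerkinLadderDiscretelyHomogeneousSlicesExcluded

open Set Filter MeasureTheory Topology Function
open Literature.Analysis Literature.Analysis.FluidPDE
open Summit.NavierStokesRegularity.FluidComputer
open Summit.NavierStokesRegularity.FluidComputer.AngularLadder
open Summit.NavierStokesRegularity.NavierStokesRegularity.Theses.AngularGalerkinLadder
open Summit.NavierStokesRegularity.AngularGalerkinLadderLadderLimit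

/-! ## §1 One contraction + continuity at the origin ⇒ zero -/

/-- **Discrete homogeneity of degree `−1` + continuity at `0` ⇒ zero.**  If `λ₀ w(λ₀ x) = w(x)` for
ONE `λ₀ ∈ (0, 1)` and `w` is continuous at the origin, then `w ≡ 0`: by iteration
`w(x) = λ₀ᵏ w(λ₀ᵏ x)`, and `λ₀ᵏ w(λ₀ᵏ x) → 0 · w(0) = 0`. [folklore] -/
theorem eq_zero_of_discretelyHomogeneous_of_continuousAt
    {w : EuclideanSpace ℝ (Fin 3) → EuclideanSpace ℝ (Fin 3)} (hw : ContinuousAt w 0) {lam : ℝ}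
    (h0 : 0 < lam) (h1 : lam < 1) (hhom : ∀ x, lam • w (lam • x) = w x) : ∀ x, w x = 0 := by
  -- iteration: `λ₀ᵏ • w (λ₀ᵏ • x) = w x`
  have hiter : ∀ (k : ℕ) (x), lam ^ k • w (lam ^ k • x) = w x := by
    intro k
    induction k with
    | zero => intro x; simp
    | succ k ih =>
        intro x
        have h := ih x
        rw [← hhom (lam ^ k • x), smul_smul, smul_smul, ← pow_succ'] at h
        rwa [← pow_succ] at h
  intro x
  have hpow : Tendsto (fun k : ℕ => lam ^ k) atTop (𝓝 0) :=
    tendsto_pow_atTop_nhds_zero_of_lt_one h0.le h1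
  have hwx : Tendsto (fun k : ℕ => w (lam ^ k • x)) atTop (𝓝 (w 0)) := by
    have h2 : Tendsto (fun k : ℕ => lam ^ k • x) atTop (𝓝 0) := by
      simpa using hpow.smul_const x
    exact hw.tendsto.comp h2
  have hlim : Tendsto (fun k : ℕ => lam ^ k • w (lam ^ k • x)) atTop (𝓝 0) := by
    simpa using hpow.smul hwx
  have hconst : Tendsto (fun k : ℕ => lam ^ k • w (lam ^ k • x)) atTop (𝓝 (w x)) := by
    have hE : (fun k : ℕ => lam ^ k • w (lam ^ k • x)) = fun _ => w x := funext fun k => hiter k x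
    rw [hE]
    exact tendsto_const_nhds
  exact tendsto_nhds_unique hconst hlim

/-! ## §2 (S29) PROFILE-level -/

section Profile

variable {L : ℕ} {C₀ c : ℝ} {R : EuclideanSpace ℝ (Fin 3) ≃ₗᵢ[ℝ] EuclideanSpace ℝ (Fin 3)}
  {u : ℝ → EuclideanSpace ℝ (Fin 3) → EuclideanSpace ℝ (Fin 3)}
  {p : ℝ → EuclideanSpace ℝ (Fin 3) → ℝ}
  {d : ℝ → EuclideanSpace ℝ (Fin 3) → EuclideanSpace ℝ (Fin 3)}

/-- **(S29) A rung-profile slice homogeneous under ONE contraction is zero.** -/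
theorem rungProfile_slice_eq_zero_of_discretelyHomogeneous (hP : IsRungProfile L C₀ c R u p d)
    {t : ℝ} (ht : t < 0) {lam : ℝ} (h0 : 0 < lam) (h1 : lam < 1)
    (hhom : ∀ x, lam • u t (lam • x) = u t x) : ∀ x, u t x = 0 :=
  eq_zero_of_discretelyHomogeneous_of_continuousAt
    (continuous_slice_of_continuousOn_Iio hP.classical.smooth_velocity.continuousOn
      ht).continuousAt h0 h1 hhom

/-- **(S29) for K1's witnesses**: a rung profile each of whose slices `u(t, ·)`, `t < 0`, is
homogeneous under some contraction `λ_t ∈ (0, 1)` is not a `RungIsSingular` witness. -/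
theorem not_nontrivial_rungProfile_of_discretelyHomogeneousSlices
    (hP : IsRungProfile L C₀ c R u p d)
    (hhom : ∀ t < 0, ∃ lam : ℝ, 0 < lam ∧ lam < 1 ∧ ∀ x, lam • u t (lam • x) = u t x) :
    ¬ ∃ t < 0, ∃ x, u t x ≠ 0 := by
  rintro ⟨t, ht, x, hx⟩
  obtain ⟨lam, h0, h1, hh⟩ := hhom t ht
  exact hx (rungProfile_slice_eq_zero_of_discretelyHomogeneous hP ht h0 h1 hh x)

/-- **(S29) for K2's windows**: no window profile (`0 < δ`) has a window slice `u(−1, ·)`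
homogeneous under one contraction — ANY `C₀`, ANY window, ANY rotation. -/
theorem no_windowProfile_discretelyHomogeneousSlice {cmin cmax δ ε : ℝ} (hδ : 0 < δ)
    (hW : IsWindowProfile L C₀ cmin cmax δ ε c R u p d) {lam : ℝ} (h0 : 0 < lam) (h1 : lam < 1)
    (hhom : ∀ x, lam • u (-1) (lam • x) = u (-1) x) : False := by
  obtain ⟨hP, -, -, ⟨x₀, hx₀⟩, -⟩ := hW
  rw [rungProfile_slice_eq_zero_of_discretelyHomogeneous hP (by norm_num) h0 h1 hhom x₀,
    norm_zero] at hx₀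
  exact absurd hx₀ (not_le.2 hδ)

end Profile

/-! ## §3 (S29) SEQUENCE-level -/

variable {C₀ cmin cmax δ : ℝ} {L : ℕ → ℕ} {ε c : ℕ → ℝ}
  {R : ℕ → (EuclideanSpace ℝ (Fin 3) ≃ₗᵢ[ℝ] EuclideanSpace ℝ (Fin 3))}
  {u : ℕ → ℝ → EuclideanSpace ℝ (Fin 3) → EuclideanSpace ℝ (Fin 3)}
  {p : ℕ → ℝ → EuclideanSpace ℝ (Fin 3) → ℝ}
  {d : ℕ → ℝ → EuclideanSpace ℝ (Fin 3) → EuclideanSpace ℝ (Fin 3)}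

/-- **(S29) No admissible window sequence has window slices asymptotically homogeneous under one
contraction.**  `1 < cmin`, `0 < δ`, `εₙ → 0`, window rung profiles with constant `C₀` — ANY
`C₀`, ANY rotations, ANY window — and `λ₀ uₙ(−1, λ₀ x) − uₙ(−1, x) → 0` pointwise for ONE
`λ₀ ∈ (0, 1)` are contradictory (Type-I ladder limit: continuous window slice, homogeneous under
`λ₀`, hence zero, against the inherited floor).
[cite: KochNadirashviliSereginSverak2009, Lemma 6.1 (limits of rescaled solutions)] -/
theorem no_windowSequence_asymptoticallyDiscretelyHomogeneousSlice (hcmin : 1 < cmin)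
    (hδ : 0 < δ) (hε : Tendsto ε atTop (𝓝 0))
    (hW : ∀ n, IsWindowProfile (L n) C₀ cmin cmax δ (ε n) (c n) (R n) (u n) (p n) (d n))
    {lam : ℝ} (h0 : 0 < lam) (h1 : lam < 1)
    (hdef : ∀ x, Tendsto (fun n => lam • u n (-1) (lam • x) - u n (-1) x) atTop (𝓝 0)) :
    False := by
  obtain ⟨φ, c', R', v, hφ, -, -, -, hptw, -, hvcont, -, -, -, -, -, ⟨x₀, hx₀⟩, -⟩ :=
    exists_ladderLimit_typeI hcmin hδ hε hW
  have hhom : ∀ x, lam • v (-1) (lam • x) = v (-1) x := by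
    intro x
    have h2 : Tendsto (fun n => lam • u (φ n) (-1) (lam • x) - u (φ n) (-1) x) atTop
        (𝓝 (lam • v (-1) (lam • x) - v (-1) x)) :=
      ((hptw (-1) (by norm_num) (lam • x)).const_smul lam).sub (hptw (-1) (by norm_num) x)
    exact sub_eq_zero.1 (tendsto_nhds_unique h2 ((hdef x).comp hφ.tendsto_atTop))
  have hz := eq_zero_of_discretelyHomogeneous_of_continuousAt
    (continuous_slice_of_continuousOn_Iio hvcont (by norm_num : (-1 : ℝ) < 0)).continuousAt
    h0 h1 hhom
  rw [hz x₀, norm_zero] at hx₀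
  exact absurd hx₀ (not_le.2 hδ)

/-- **(S29) in census form.** -/
theorem no_windowSequence_asymptoticallyDiscretelyHomogeneousSlice_census (hcmin : 1 < cmin)
    (hδ : 0 < δ) (hε : Tendsto ε atTop (𝓝 0))
    (hW : ∀ n, IsWindowProfile (L n) C₀ cmin cmax δ (ε n) (c n) (R n) (u n) (p n) (d n)) :
    ¬ ∃ lam : ℝ, 0 < lam ∧ lam < 1 ∧
        ∀ x, Tendsto (fun n => lam • u n (-1) (lam • x) - u n (-1) x) atTop (𝓝 0) :=
  fun ⟨_, h0, h1, hdef⟩ =>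
    no_windowSequence_asymptoticallyDiscretelyHomogeneousSlice hcmin hδ hε hW h0 h1 hdef

end Summit.NavierStokesRegularity.AngularGalerkinLadderDiscretelyHomogeneousSlicesExcluded
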